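import Summits.NavierStokesRegularity.NavierStokesRegularity.Theorems.EulerZoomLiouvillePowerGaugeEulerLiouvilleEnergySaturationShellLoc

/-!
# Energy saturation on rung C1 of the crux `EulerZoomLiouville.PowerGaugeEulerLiouville` — LARGE-SCALE re-plumb, II:
# ball quantities through the tail supremum under THRESHOLDED ball growth
# (crux = stmt-NavierStokesRegularity-19832, route №10 `EulerZoomLiouville`, line `birth`)

Width seat `ns-ezl-w1` (RESIDUE-MEMO-19832-g9 §2).  Sequel of `…EnergySaturationShellLoc`: the tree's
`lintegral_ball_cube_le_of_sup` and `lintegral_ball_pressure_one_le` (`…EnergySaturationShellReal`) re-proved VERBATIM with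
the all-scale `A`-growth and the global `E`/`D`-weights replaced by the thresholded ball forms (A₁), (E₁), (D₁) for `L ≥ 1`
(the only radii used are `R ≥ 1` and `3R`):

* `lintegral_ball_cube_le_of_sup_loc` — `∫_{B_R}|V|³ ≤ K₂ S^{1/2} R^{(6−9ρ)/4}` for `R ≥ 1` when `∫σ(R⁻¹y)|V|² ≤ R^{1−2ρ}S`,
  `0 ≤ S ≤ 3c`;
* `lintegral_ball_pressure_one_le_loc` — `∫_{B_R}|P| ≤ v₁^{1/3} c_D^{2/3} R^{(7−4ρ)/3}` for `R ≥ 1`.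

WHAT THIS IS NOT: not NS regularity, not the crux, not rung C1 — plumbing for the shifted / past-exact sub-extremal stratum;
`--supports` stmt-19832. [folklore]
-/

noncomputable section

set_option linter.dupNamespace false

open MeasureTheory Set Filter Topology Metric Function TopologicalSpace
open scoped ENNReal NNReal RealInnerProductSpace ContDiff

namespace Summit.NavierStokesRegularity.NavierStokesRegularity.Theorems.PowerGaugeEulerLiouville

open Literature.Analysis Literature.Analysis.FunctionSpaces Literature.Analysis.FluidPDE

namespace EnergySaturation

variable {ρ : ℝ} {σ : EuclideanSpace ℝ (Fin 3) → ℝ}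
  {V : EuclideanSpace ℝ (Fin 3) → EuclideanSpace ℝ (Fin 3)} {P : EuclideanSpace ℝ (Fin 3) → ℝ}
  {G : EuclideanSpace ℝ (Fin 3) → EuclideanSpace ℝ (Fin 3) →L[ℝ] EuclideanSpace ℝ (Fin 3)}

/-! ## Ball quantities through the tail supremum `S` (thresholded inputs) -/

/-- **Cubic ball bound through the tail supremum, LARGE-SCALE inputs** (A₁), (E₁): if `∫σ(R⁻¹y)|V|² ≤ R^{1−2ρ} S` with
`0 ≤ S ≤ 3c` and `R ≥ 1`, then `∫_{B_R}|V|³ ≤ K₂ S^{1/2} R^{(6−9ρ)/4}` with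
`K₂ = K^{3/2} C_G^{3/4} (3c)^{1/4}` (file III's bound `lintegral_ball_cube_le_loc`). [folklore] -/
theorem lintegral_ball_cube_le_of_sup_loc (hρ : 0 < ρ) (hρ1 : ρ < 1)
    (hσ : IsTestFunctionOn (⊤ : Opens (EuclideanSpace ℝ (Fin 3))) σ) (h0 : ∀ z, 0 ≤ σ z)
    (h1 : ∀ z, σ z ≤ 1) (hone : ∀ z, ‖z‖ ≤ 1 → σ z = 1) (hzero : ∀ z, 2 ≤ ‖z‖ → σ z = 0)
    {M : ℝ} (hM : ∀ z, ‖fderiv ℝ σ z‖ ≤ M)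
    (hVm : AEStronglyMeasurable V volume) (hGm : AEStronglyMeasurable G volume)
    (hVG : HasWeakFDerivOn (⊤ : Opens (EuclideanSpace ℝ (Fin 3))) volume V G) {c : ℝ≥0}
    (hA : ∀ L : ℝ, 1 ≤ L → ∫⁻ y in ball (0 : EuclideanSpace ℝ (Fin 3)) L, ‖V y‖ₑ ^ 2 ≤
      (c : ℝ≥0∞) * ENNReal.ofReal (L ^ (1 - 2 * ρ)))
    (hE : ∀ L : ℝ, 1 ≤ L →
      ∫⁻ y in ball (0 : EuclideanSpace ℝ (Fin 3)) L, ENNReal.ofReal (frobeniusNormSq (G y)) ≤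
        ENNReal.ofReal (L ^ (1 - ρ)) * (ENNReal.ofReal ((1 - ρ) / (2 + ρ)) * (c : ℝ≥0∞)))
    {S : ℝ} (hS : 0 ≤ S) (hS3 : S ≤ 3 * c) {R : ℝ} (hR : 1 ≤ R)
    (hsup : ∫ y, σ (R⁻¹ • y) * ‖V y‖ ^ 2 ≤ R ^ (1 - 2 * ρ) * S) :
    ∫⁻ y in ball (0 : EuclideanSpace ℝ (Fin 3)) R, ‖V y‖ₑ ^ (3 : ℕ) ≤
      ENNReal.ofReal (((SNormLESNormFDerivOfEqConst (EuclideanSpace ℝ (Fin 3))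
            (volume : Measure (EuclideanSpace ℝ (Fin 3))) 2 : ℝ) ^ (3 / 2 : ℝ) *
          (2 * (3 : ℝ) ^ (1 - ρ) * ((1 - ρ) / (2 + ρ) * c) +
            6 * M ^ 2 * (3 : ℝ) ^ (1 - 2 * ρ) * c) ^ (3 / 4 : ℝ) * (3 * c) ^ (1 / 4 : ℝ)) *
        S ^ (1 / 2 : ℝ) * R ^ ((6 - 9 * ρ) / 4)) := by
  have hR0 : 0 < R := lt_of_lt_of_le one_pos hR
  set K : ℝ := (SNormLESNormFDerivOfEqConst (EuclideanSpace ℝ (Fin 3))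
    (volume : Measure (EuclideanSpace ℝ (Fin 3))) 2 : ℝ) with hK
  have hK0 : 0 ≤ K := NNReal.coe_nonneg _
  set CG : ℝ := 2 * (3 : ℝ) ^ (1 - ρ) * ((1 - ρ) / (2 + ρ) * c) +
    6 * M ^ 2 * (3 : ℝ) ^ (1 - 2 * ρ) * c with hCG
  have h1ρ : 0 ≤ (1 - ρ) / (2 + ρ) := by apply div_nonneg <;> linarith
  have hc0 : (0 : ℝ) ≤ c := c.2
  have hCG0 : 0 ≤ CG := by positivity
  have hI0 : 0 ≤ ∫ y, σ (R⁻¹ • y) * ‖V y‖ ^ 2 := integral_nonneg fun y => mul_nonneg (h0 _) (sq_nonneg _)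
  have hcube := lintegral_ball_cube_le_loc hρ hρ1 hσ h0 h1 hone hzero hM hVm hGm hVG hA hE hR
  refine hcube.trans ?_
  -- rewrite the `ℝ≥0∞` bound as `ofReal` of a real number
  set I : ℝ := ∫ y, σ (R⁻¹ • y) * ‖V y‖ ^ 2 with hI
  have eK : ((SNormLESNormFDerivOfEqConst (EuclideanSpace ℝ (Fin 3))
      (volume : Measure (EuclideanSpace ℝ (Fin 3))) 2 : ℝ≥0∞)) ^ (3 / 2 : ℝ) = ENNReal.ofReal (K ^ (3 / 2 : ℝ)) := by
    rw [hK, ← ENNReal.ofReal_coe_nnreal, ENNReal.ofReal_rpow_of_nonneg (NNReal.coe_nonneg _) (by norm_num)]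
  have eR : ENNReal.ofReal I ^ (3 / 4 : ℝ) * (ENNReal.ofReal (K ^ (3 / 2 : ℝ)) *
      ENNReal.ofReal (CG * R ^ (1 - ρ)) ^ (3 / 4 : ℝ)) =
      ENNReal.ofReal (I ^ (3 / 4 : ℝ) * (K ^ (3 / 2 : ℝ) * (CG * R ^ (1 - ρ)) ^ (3 / 4 : ℝ))) := by
    rw [ENNReal.ofReal_rpow_of_nonneg hI0 (by norm_num),
      ENNReal.ofReal_rpow_of_nonneg (by positivity) (by norm_num),
      ← ENNReal.ofReal_mul (by positivity), ← ENNReal.ofReal_mul (by positivity)]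
  rw [eK, eR]
  refine ENNReal.ofReal_le_ofReal ?_
  -- the real inequality
  have hI34 : I ^ (3 / 4 : ℝ) ≤ (R ^ (1 - 2 * ρ) * S) ^ (3 / 4 : ℝ) :=
    Real.rpow_le_rpow hI0 hsup (by norm_num)
  have hS34 : S ^ (3 / 4 : ℝ) ≤ (3 * c) ^ (1 / 4 : ℝ) * S ^ (1 / 2 : ℝ) := by
    have := rpow_le_rpow_half hS hS3 (by norm_num : (1:ℝ) / 2 ≤ 3 / 4)
    norm_num at this ⊢
    exact this
  have e1 : (R ^ (1 - 2 * ρ) * S) ^ (3 / 4 : ℝ) = R ^ ((1 - 2 * ρ) * (3 / 4)) * S ^ (3 / 4 : ℝ) := by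
    rw [Real.mul_rpow (Real.rpow_nonneg hR0.le _) hS, ← Real.rpow_mul hR0.le]
  have e2 : (CG * R ^ (1 - ρ)) ^ (3 / 4 : ℝ) = CG ^ (3 / 4 : ℝ) * R ^ ((1 - ρ) * (3 / 4)) := by
    rw [Real.mul_rpow hCG0 (Real.rpow_nonneg hR0.le _), ← Real.rpow_mul hR0.le]
  have e3 : R ^ ((1 - 2 * ρ) * (3 / 4)) * R ^ ((1 - ρ) * (3 / 4)) = R ^ ((6 - 9 * ρ) / 4) := by
    rw [← Real.rpow_add hR0]; ring_nf
  calc I ^ (3 / 4 : ℝ) * (K ^ (3 / 2 : ℝ) * (CG * R ^ (1 - ρ)) ^ (3 / 4 : ℝ))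
      ≤ (R ^ (1 - 2 * ρ) * S) ^ (3 / 4 : ℝ) * (K ^ (3 / 2 : ℝ) * (CG * R ^ (1 - ρ)) ^ (3 / 4 : ℝ)) := by
        gcongr
    _ = K ^ (3 / 2 : ℝ) * CG ^ (3 / 4 : ℝ) * S ^ (3 / 4 : ℝ) *
          (R ^ ((1 - 2 * ρ) * (3 / 4)) * R ^ ((1 - ρ) * (3 / 4))) := by rw [e1, e2]; ring
    _ ≤ K ^ (3 / 2 : ℝ) * CG ^ (3 / 4 : ℝ) * ((3 * c) ^ (1 / 4 : ℝ) * S ^ (1 / 2 : ℝ)) *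
          (R ^ ((1 - 2 * ρ) * (3 / 4)) * R ^ ((1 - ρ) * (3 / 4))) := by
        gcongr
    _ = K ^ (3 / 2 : ℝ) * CG ^ (3 / 4 : ℝ) * (3 * c) ^ (1 / 4 : ℝ) * S ^ (1 / 2 : ℝ) *
          R ^ ((6 - 9 * ρ) / 4) := by rw [e3]; ring

/-- **`L¹` mass of the pressure on a ball, `R ≥ 1`** (Hölder `(3, 3/2)` and the thresholded `D`-growth (D₁)):
`∫_{B_R}|P| ≤ v₁^{1/3} c_D^{2/3} R^{(7−4ρ)/3}`, `c_D = ((2−2ρ)/(2+ρ))c`. [folklore] -/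
theorem lintegral_ball_pressure_one_le_loc (hρ : 0 < ρ) (hρ1 : ρ < 1) (hPm : AEStronglyMeasurable P volume)
    {c : ℝ≥0}
    (hD : ∀ L : ℝ, 1 ≤ L →
      ∫⁻ y in ball (0 : EuclideanSpace ℝ (Fin 3)) L, ‖P y‖ₑ ^ (3 / 2 : ℝ) ≤
        ENNReal.ofReal (L ^ (2 - 2 * ρ)) * (ENNReal.ofReal ((2 - 2 * ρ) / (2 + ρ)) * (c : ℝ≥0∞))) {R : ℝ} (hR1 : 1 ≤ R) :
    ∫⁻ y in ball (0 : EuclideanSpace ℝ (Fin 3)) R, ‖P y‖ₑ ≤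
      ENNReal.ofReal ((volume (ball (0 : EuclideanSpace ℝ (Fin 3)) 1)).toReal ^ (1 / 3 : ℝ) *
        ((2 - 2 * ρ) / (2 + ρ) * c) ^ (2 / 3 : ℝ) * R ^ ((7 - 4 * ρ) / 3)) := by
  have hR : 0 < R := lt_of_lt_of_le one_pos hR1
  set v₁ : ℝ := (volume (ball (0 : EuclideanSpace ℝ (Fin 3)) 1)).toReal with hv₁
  have hv₁0 : 0 ≤ v₁ := ENNReal.toReal_nonneg
  have hcD : 0 ≤ (2 - 2 * ρ) / (2 + ρ) * c := by
    have : 0 ≤ (2 - 2 * ρ) / (2 + ρ) := by apply div_nonneg <;> linarith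
    exact mul_nonneg this c.2
  set μ : Measure (EuclideanSpace ℝ (Fin 3)) := volume.restrict (ball (0 : EuclideanSpace ℝ (Fin 3)) R) with hμ
  have hpq : (3 : ℝ).HolderConjugate (3 / 2) := by rw [Real.holderConjugate_iff]; norm_num
  have hH := ENNReal.lintegral_mul_le_Lp_mul_Lq μ hpq (f := fun _ => (1 : ℝ≥0∞)) (g := fun y => ‖P y‖ₑ)
    aemeasurable_const hPm.restrict.enorm
  simp only [Pi.mul_apply, one_mul, ENNReal.one_rpow, lintegral_const, hμ,
    Measure.restrict_apply_univ] at hH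
  have hvol : volume (ball (0 : EuclideanSpace ℝ (Fin 3)) R) = ENNReal.ofReal (R ^ 3 * v₁) :=
    volume_ball_eq_ofReal hR
  have hD' : ∫⁻ y in ball (0 : EuclideanSpace ℝ (Fin 3)) R, ‖P y‖ₑ ^ (3 / 2 : ℝ) ≤
      ENNReal.ofReal (R ^ (2 - 2 * ρ) * ((2 - 2 * ρ) / (2 + ρ) * c)) := by
    refine (hD R hR1).trans (le_of_eq ?_)
    have h22 : 0 ≤ (2 - 2 * ρ) / (2 + ρ) := by apply div_nonneg <;> linarith
    rw [ENNReal.ofReal_mul (by positivity), ENNReal.ofReal_mul h22, ENNReal.ofReal_coe_nnreal]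
  calc ∫⁻ y in ball (0 : EuclideanSpace ℝ (Fin 3)) R, ‖P y‖ₑ
      ≤ (volume (ball (0 : EuclideanSpace ℝ (Fin 3)) R)) ^ (1 / (3 : ℝ)) *
          (∫⁻ y in ball (0 : EuclideanSpace ℝ (Fin 3)) R, ‖P y‖ₑ ^ (3 / 2 : ℝ)) ^ (1 / (3 / 2 : ℝ)) := hH
    _ ≤ (ENNReal.ofReal (R ^ 3 * v₁)) ^ (1 / (3 : ℝ)) *
          (ENNReal.ofReal (R ^ (2 - 2 * ρ) * ((2 - 2 * ρ) / (2 + ρ) * c))) ^ (1 / (3 / 2 : ℝ)) := by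
        rw [hvol]; gcongr
    _ = ENNReal.ofReal ((R ^ 3 * v₁) ^ (1 / 3 : ℝ) * (R ^ (2 - 2 * ρ) * ((2 - 2 * ρ) / (2 + ρ) * c)) ^ (2 / 3 : ℝ)) := by
        rw [show (1 / (3 / 2 : ℝ)) = 2 / 3 by norm_num,
          ENNReal.ofReal_rpow_of_nonneg (by positivity) (by norm_num),
          ENNReal.ofReal_rpow_of_nonneg (by positivity) (by norm_num), ← ENNReal.ofReal_mul (by positivity)]
    _ = ENNReal.ofReal (v₁ ^ (1 / 3 : ℝ) * ((2 - 2 * ρ) / (2 + ρ) * c) ^ (2 / 3 : ℝ) * R ^ ((7 - 4 * ρ) / 3)) := by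
        congr 1
        rw [show R ^ 3 = R ^ (3 : ℝ) by norm_cast, Real.mul_rpow (by positivity) hv₁0,
          Real.mul_rpow (by positivity) hcD, ← Real.rpow_mul hR.le, ← Real.rpow_mul hR.le]
        have e4 : R ^ ((3 : ℝ) * (1 / 3)) * R ^ ((2 - 2 * ρ) * (2 / 3)) = R ^ ((7 - 4 * ρ) / 3) := by
          rw [← Real.rpow_add hR]; ring_nf
        calc R ^ ((3 : ℝ) * (1 / 3)) * v₁ ^ (1 / 3 : ℝ) * (R ^ ((2 - 2 * ρ) * (2 / 3)) * ((2 - 2 * ρ) / (2 + ρ) * c) ^ (2 / 3 : ℝ))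
            = v₁ ^ (1 / 3 : ℝ) * ((2 - 2 * ρ) / (2 + ρ) * c) ^ (2 / 3 : ℝ) *
                (R ^ ((3 : ℝ) * (1 / 3)) * R ^ ((2 - 2 * ρ) * (2 / 3))) := by ring
          _ = _ := by rw [e4]

end EnergySaturation

end Summit.NavierStokesRegularity.NavierStokesRegularity.Theorems.PowerGaugeEulerLiouville

end
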